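import Summits.RiemannHypothesis.RiemannHypothesis.Theorems.PfPersistenceFfWeilCriterionSharpQ4Sums

/-!
# Function-field mirror: the positivity depth `2g - 1` is sharp at the FIXED prime power `q = 4`, every `g ≥ 4`
(pub-rhpf, seat ffmirror-2 gen 7; HONEST FRAMING: mechanism/rigidity campaign — no RH claims)

Door D-D: the finite Weil criterion decides the function-field RH of an FE-honest datum `(q, h)`, `deg h = 2g`,
at window depth `2g - 1` (`PfPersistenceFfWeilCriterion`), sharp for every `g` at `q = (6g - 2)²`
(`PfPersistenceFfWeilCriterionSharpAll`).  The open rider (ADJ-LOG A290 (A3); ESCAPE-DOORS v1.17 door D-D, R1/R2):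
does the sharpness survive at a FIXED prime power `q`?  THIS FILE: yes, at `q = 4 = 2²`, uniformly in `g ≥ 4`,
with the MONIC integer family `H_d = hQ4 d` (`g = d + 1 ≥ 4`) of `PfPersistenceFfWeilCriterionSharpQ4Sums`:
* `windowForm_hQ4_apply`: by the closed form of the power sums the depth-`2d` window (size `2d + 1 = 2g - 1`) is
  the real symmetric Toeplitz matrix `T = ((2d+1)/2)·1 + ½·J + ½·(e(|i-j|))`, `e(n) = s_n/2^n - 1`, with
  `e(n) = 0 (n < d)` and `0 ≤ e(n) ≤ ε_d = (4d·2^d + d)/4^d` on the window (`eDevQ4_*`, `sQ4_mul_le`);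
* `rowsum_eDevQ4_le` (Gershgorin): a row of `(e(|i-j|))` has at most `d + 1` nonzero entries
  (`card_filter_dist_ge`), so its sum is `≤ (d+1)ε_d ≤ 2d + 1` for `d ≥ 3` (`rowsum_key_ineq`: `2d + 2 ≤ 2^d`);
* `windowForm_hQ4_posSemidef` (`d ≥ 3`): `x*Tx ≥ ((2d+1)/2)|x|² + ½|Σx|² - ½ Σ_i (row sum)_i |x_i|² ≥ 0`;
* `exists_real_root_hQ4`: `H_d(2) = -2^{d+3} < 0 < H_d(4)`, a real root in `(2, 4]` off the circle `|α| = 2 = √q`,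
  so the function-field RH FAILS for `(4, H_d)` (`exists_offCircle_hQ4`);
* `sharp_witness_q4` (`d ≥ 3`, i.e. `g ≥ 4`): MONIC, FE-honest, RH-false, degree `2g`, `T_{2g-2} ⪰ 0`,
  `T_{2g-1}` not PSD (by `weilWindowForm_not_posSemidef_of_offCircle`); `g ≤ 3` and the all-`g` corollary with
  the SAME `q = 4` are assembled in the sequel.  NOT said: anything about `ζ`, or about odd prime powers
  `q = p^{2k+1}` (open).  'RH' = the function-field statement `∀ α ∈ frobRoots h, ‖α‖ = √q` for the datum at hand.
-/

set_option linter.dupNamespace false  -- the mandated namespace repeats `RiemannHypothesis`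

noncomputable section

open Polynomial Matrix Finset
open scoped ComplexOrder ComplexConjugate

namespace Summit.RiemannHypothesis.RiemannHypothesis.Theorems.PfPersistence.FfAngleTwin

/-! ## Size of the closed form: `2^n ≤ s_n ≤ 2^n (1 + ε_d)` on the window, `ε_d = (4d·2^d + d)/4^d` -/

/-- Lower bound `2^n ≤ s_n`. [folklore] -/
theorem two_pow_le_sQ4 (d n : ℕ) : 2 ^ n ≤ sQ4 d n := by
  unfold sQ4; omega

/-- Upper bound `s_n · 4^d ≤ 2^n (4^d + 4d·2^d + d)` on the window `n ≤ 2d` (equality at `n = 2d`). [folklore] -/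
theorem sQ4_mul_le (d n : ℕ) (hd : 2 ≤ d) (hn : n ≤ 2 * d) :
    sQ4 d n * 4 ^ d ≤ 2 ^ n * (4 ^ d + 4 * d * 2 ^ d + d) := by
  have h4 : (4:ℕ) ^ d = 2 ^ d * 2 ^ d := by rw [← mul_pow]; norm_num
  unfold sQ4
  by_cases hdn : d ≤ n
  · obtain ⟨m, rfl⟩ : ∃ m, n = d + m := ⟨n - d, by omega⟩
    rw [if_pos hdn, show d + m - d = m by omega, pow_add, h4]
    by_cases htop : d + m = 2 * d
    · have hmd : m = d := by omega
      rw [if_pos (by omega : d + 2 ≤ d + m), if_pos htop, hmd]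
      exact le_of_eq (by ring)
    · rw [if_neg htop, add_zero]
      have hm : (d + m) * 2 ≤ 4 * d := by omega
      have key := Nat.mul_le_mul_right (2 ^ d * 2 ^ d * 2 ^ m) hm
      split_ifs
      · nlinarith [key, Nat.zero_le (d * (2 ^ d * 2 ^ m))]
      · nlinarith [key, Nat.zero_le (d * (2 ^ d * 2 ^ m)), Nat.zero_le ((d + m) * (2 ^ d * 2 ^ d * 2 ^ m))]
  · rw [if_neg hdn, if_neg (by omega), add_zero, add_zero]
    exact Nat.mul_le_mul_left _ (by omega)

/-- The numerical heart: `(d + 1)(4d·2^d + d) ≤ (2d + 1)·4^d` for `d ≥ 3` (uses `2d + 2 ≤ 2^d`). [folklore] -/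
theorem rowsum_key_ineq {d : ℕ} (hd : 3 ≤ d) : (d + 1) * (4 * d * 2 ^ d + d) ≤ (2 * d + 1) * 4 ^ d := by
  have hP : 2 * d + 2 ≤ 2 ^ d := by
    induction d, hd using Nat.le_induction with
    | base => norm_num
    | succ k _ ih => rw [pow_succ]; omega
  have h4 : (4:ℕ) ^ d = 2 ^ d * 2 ^ d := by rw [← mul_pow]; norm_num
  have hdP : d ≤ 2 ^ d := by omega
  rw [h4]
  calc (d + 1) * (4 * d * 2 ^ d + d)
      ≤ (d + 1) * (4 * d * 2 ^ d + 2 ^ d) := Nat.mul_le_mul_left _ (by omega)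
    _ = ((d + 1) * (4 * d + 1)) * 2 ^ d := by ring
    _ ≤ ((2 * d + 1) * (2 * d + 2)) * 2 ^ d := Nat.mul_le_mul_right _ (by nlinarith)
    _ = (2 * d + 1) * ((2 * d + 2) * 2 ^ d) := by ring
    _ ≤ (2 * d + 1) * (2 ^ d * 2 ^ d) := Nat.mul_le_mul_left _ (Nat.mul_le_mul_right _ hP)

/-! ## The real model of the window `T_{2d}(4, H_d)` -/

/-- The deviation `e(n) = s_n / 2^n - 1` of the normalised power sum from `1` (`e(0) := 0`). [folklore] -/
def eDevQ4 (d n : ℕ) : ℝ := if n = 0 then 0 else (sQ4 d n : ℝ) / 2 ^ n - 1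

/-- The uniform bound `ε_d = (4d·2^d + d) / 4^d` of the deviations on the window. [folklore] -/
def epsQ4 (d : ℕ) : ℝ := (4 * d * 2 ^ d + d) / 4 ^ d

/-- `e(n) ≥ 0`. [folklore] -/
theorem eDevQ4_nonneg (d n : ℕ) : 0 ≤ eDevQ4 d n := by
  unfold eDevQ4
  split_ifs with h
  · exact le_rfl
  · have h1 : (2 : ℝ) ^ n ≤ (sQ4 d n : ℝ) := by exact_mod_cast two_pow_le_sQ4 d n
    have h2 : (0 : ℝ) < 2 ^ n := by positivity
    rw [sub_nonneg, le_div_iff₀ h2, one_mul]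
    exact h1

/-- `e(n) = 0` below the window's first nontrivial distance: `n < d`. [folklore] -/
theorem eDevQ4_eq_zero_of_lt {d n : ℕ} (h : n < d) : eDevQ4 d n = 0 := by
  unfold eDevQ4
  split_ifs with h0
  · rfl
  · unfold sQ4
    rw [if_neg (by omega), if_neg (by omega), add_zero, add_zero]
    have h2 : (0 : ℝ) < 2 ^ n := by positivity
    push_cast
    rw [div_self (ne_of_gt h2), sub_self]

/-- `e(n) ≤ ε_d` on the window `n ≤ 2d`. [folklore] -/
theorem eDevQ4_le_eps (d n : ℕ) (hd : 2 ≤ d) (hn : n ≤ 2 * d) : eDevQ4 d n ≤ epsQ4 d := by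
  have h4 : (0 : ℝ) < 4 ^ d := by positivity
  unfold eDevQ4 epsQ4
  split_ifs with h0
  · positivity
  · have key : (sQ4 d n : ℝ) * 4 ^ d ≤ 2 ^ n * (4 ^ d + 4 * d * 2 ^ d + d) := by
      exact_mod_cast sQ4_mul_le d n hd hn
    have h2 : (0 : ℝ) < 2 ^ n := by positivity
    have h3 : (sQ4 d n : ℝ) / 2 ^ n ≤ (4 ^ d + 4 * d * 2 ^ d + d) / 4 ^ d := by
      rw [div_le_div_iff₀ h2 h4]; linarith
    calc (sQ4 d n : ℝ) / 2 ^ n - 1 ≤ (4 ^ d + 4 * d * 2 ^ d + d) / 4 ^ d - 1 := by linarith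
      _ = (4 * d * 2 ^ d + d) / 4 ^ d := by field_simp; ring

/-- In a window of size `2d + 1`, at most `d + 1` indices lie at distance `≥ d` from a given index. [folklore] -/
theorem card_filter_dist_ge (d : ℕ) (i : Fin (2 * d + 1)) :
    ((univ : Finset (Fin (2 * d + 1))).filter (fun j : Fin (2 * d + 1) => d ≤ Nat.dist i j)).card ≤ d + 1 := by
  have htot := Finset.card_filter_add_card_filter_not
    (s := (univ : Finset (Fin (2 * d + 1)))) (fun j : Fin (2 * d + 1) => d ≤ Nat.dist i j)
  rw [Finset.card_univ, Fintype.card_fin] at htot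
  suffices h : d ≤ ((univ : Finset (Fin (2 * d + 1))).filter (fun j : Fin (2 * d + 1) => ¬ d ≤ Nat.dist i j)).card by omega
  have hi := i.isLt
  by_cases hle : (i : ℕ) ≤ d
  · let f : Fin d → Fin (2 * d + 1) := fun t => ⟨i + t, by omega⟩
    have hinj : Function.Injective f := by
      intro a b hab
      simp only [f, Fin.mk.injEq] at hab
      exact Fin.ext (by omega)
    calc d = (univ.image f).card := by rw [Finset.card_image_of_injective _ hinj, card_univ, Fintype.card_fin]
      _ ≤ _ := Finset.card_le_card fun j hj => by
          obtain ⟨t, -, rfl⟩ := Finset.mem_image.1 hj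
          simp only [Finset.mem_filter, Finset.mem_univ, true_and, f]
          unfold Nat.dist; omega
  · let f : Fin d → Fin (2 * d + 1) := fun t => ⟨i - t, by omega⟩
    have hinj : Function.Injective f := by
      intro a b hab
      simp only [f, Fin.mk.injEq] at hab
      exact Fin.ext (by omega)
    calc d = (univ.image f).card := by rw [Finset.card_image_of_injective _ hinj, card_univ, Fintype.card_fin]
      _ ≤ _ := Finset.card_le_card fun j hj => by
          obtain ⟨t, -, rfl⟩ := Finset.mem_image.1 hj
          simp only [Finset.mem_filter, Finset.mem_univ, true_and, f]
          unfold Nat.dist; omega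

/-- GERSHGORIN ROW BOUND: every row sum of the deviation matrix `(e(|i-j|))` on the window is `≤ 2d + 1`
(`d ≥ 3`): at most `d + 1` nonzero entries, each `≤ ε_d`, and `(d+1) ε_d ≤ 2d + 1`. [folklore] -/
theorem rowsum_eDevQ4_le (d : ℕ) (hd : 3 ≤ d) (i : Fin (2 * d + 1)) :
    ∑ j : Fin (2 * d + 1), eDevQ4 d (Nat.dist i j) ≤ 2 * d + 1 := by
  have h4 : (0 : ℝ) < 4 ^ d := by positivity
  have heps0 : 0 ≤ epsQ4 d := by unfold epsQ4; positivity
  have hkey : ((d : ℝ) + 1) * epsQ4 d ≤ 2 * d + 1 := by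
    unfold epsQ4
    rw [← mul_div_assoc, div_le_iff₀ h4]
    exact_mod_cast rowsum_key_ineq hd
  have hdist : ∀ j : Fin (2 * d + 1), Nat.dist i j ≤ 2 * d := fun j => by
    have hi := i.isLt; have hj := j.isLt; unfold Nat.dist; omega
  calc ∑ j : Fin (2 * d + 1), eDevQ4 d (Nat.dist i j)
      = ∑ j ∈ (univ : Finset (Fin (2 * d + 1))).filter (fun j : Fin (2 * d + 1) => d ≤ Nat.dist i j),
          eDevQ4 d (Nat.dist i j) := by
        refine (Finset.sum_filter_of_ne fun j _ hne => ?_).symm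
        by_contra hlt
        exact hne (eDevQ4_eq_zero_of_lt (by omega))
    _ ≤ ∑ j ∈ (univ : Finset (Fin (2 * d + 1))).filter (fun j : Fin (2 * d + 1) => d ≤ Nat.dist i j), epsQ4 d :=
        Finset.sum_le_sum fun j _ => eDevQ4_le_eps d _ (by omega) (hdist j)
    _ = (((univ : Finset (Fin (2 * d + 1))).filter (fun j : Fin (2 * d + 1) => d ≤ Nat.dist i j)).card : ℝ) * epsQ4 d := by
        rw [Finset.sum_const, nsmul_eq_mul]
    _ ≤ ((d : ℝ) + 1) * epsQ4 d := by
        refine mul_le_mul_of_nonneg_right ?_ heps0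
        exact_mod_cast card_filter_dist_ge d i
    _ ≤ 2 * d + 1 := hkey

/-- The real symmetric model of the window entries: `t_{ij} = ((2d+1)/2)·[i = j] + 1/2 + e(|i-j|)/2`. [folklore] -/
def tQ4 (d : ℕ) (i j : Fin (2 * d + 1)) : ℝ :=
  (if i = j then (2 * d + 1 : ℝ) / 2 else 0) + 1 / 2 + eDevQ4 d (Nat.dist i j) / 2

/-- `t` is symmetric. [folklore] -/
theorem tQ4_symm (d : ℕ) (i j : Fin (2 * d + 1)) : tQ4 d j i = tQ4 d i j := by
  unfold tQ4
  rw [Nat.dist_comm]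
  by_cases h : i = j
  · subst h; rfl
  · rw [if_neg (Ne.symm h), if_neg h]

/-- ENTRY FORMULA: the window `T_{2d}(4, H_d)` (size `2d + 1 = 2g - 1`) has the real entries `tQ4 d i j`:
`K(0) = g = d + 1`, `K(n) = s_n / 2^{n+1} = (1 + e(n))/2` for `1 ≤ n ≤ 2d`. [folklore] -/
theorem windowForm_hQ4_apply (d : ℕ) (hd : 3 ≤ d) (i j : Fin (2 * d + 1)) :
    ffWindowForm 4 (frobRoots (hQ4 d)) (2 * d) i j = ((tQ4 d i j : ℝ) : ℂ) := by
  simp only [ffWindowForm, Matrix.of_apply, tQ4]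
  by_cases hij : i = j
  · subst hij
    rw [Nat.dist_self, ffKernel_zero, card_frobRoots_eq_natDegree, natDegree_hQ4 d (by omega), if_pos rfl,
      eDevQ4, if_pos rfl]
    push_cast; ring
  · have hn1 : 1 ≤ Nat.dist i j := by
      rcases Nat.eq_zero_or_pos (Nat.dist i j) with h0 | h0
      · exact absurd (Fin.ext (Nat.eq_of_dist_eq_zero h0)) hij
      · exact h0
    have hn : Nat.dist i j ≤ 2 * d := by
      have hi := i.isLt; have hj := j.isLt; unfold Nat.dist; omega
    rw [ffKernel_eq, powerSum_hQ4 d hd _ hn1 hn, sqrt_four, if_neg hij, eDevQ4, if_neg (by omega)]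
    push_cast
    field_simp
    ring

/-- POSITIVITY of the depth-`2g - 2` window of the RH-false datum `(4, H_d)`, EVERY `d ≥ 3`:
`x* T x = ((2d+1)/2)|x|² + ½|Σ x|² + ½ Σ e(|i-j|) Re(x̄_i x_j)` and, by `|Re(x̄_i x_j)| ≤ (|x_i|² + |x_j|²)/2`
and the symmetry of `e`, `Σ e(|i-j|) Re(x̄_i x_j) ≥ -Σ_i (Σ_j e(|i-j|)) |x_i|² ≥ -(2d+1)|x|²` (Gershgorin row
bound `rowsum_eDevQ4_le`).  Hence `x* T x ≥ ½|Σ x|² ≥ 0`. [folklore] -/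
theorem windowForm_hQ4_posSemidef (d : ℕ) (hd : 3 ≤ d) :
    (ffWindowForm 4 (frobRoots (hQ4 d)) (2 * d)).PosSemidef := by
  refine Matrix.PosSemidef.of_dotProduct_mulVec_nonneg ?_ ?_
  · refine Matrix.IsHermitian.ext fun i j => ?_
    rw [windowForm_hQ4_apply d hd, windowForm_hQ4_apply d hd, tQ4_symm, Complex.star_def,
      Complex.conj_ofReal]
  intro x
  have he_symm : ∀ i j : Fin (2 * d + 1), eDevQ4 d (Nat.dist j i) = eDevQ4 d (Nat.dist i j) :=
    fun i j => by rw [Nat.dist_comm]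
  have he0 : ∀ i j : Fin (2 * d + 1), 0 ≤ eDevQ4 d (Nat.dist i j) := fun i j => eDevQ4_nonneg d _
  -- Step A: expand the quadratic form through the real model of the entries.
  have hQ : star x ⬝ᵥ (ffWindowForm 4 (frobRoots (hQ4 d)) (2 * d) *ᵥ x) =
      (2 * d + 1) / 2 * (∑ i, conj (x i) * x i) + (∑ i, conj (x i)) * (∑ j, x j) / 2 +
        (∑ i : Fin (2 * d + 1), ∑ j : Fin (2 * d + 1), (eDevQ4 d (Nat.dist i j) : ℂ) * (conj (x i) * x j)) / 2 := by
    have hterm : ∀ i j : Fin (2 * d + 1),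
        star (x i) * (ffWindowForm 4 (frobRoots (hQ4 d)) (2 * d) i j * x j) =
          (2 * d + 1) / 2 * (if i = j then conj (x i) * x j else 0) + conj (x i) * x j / 2 +
            (eDevQ4 d (Nat.dist i j) : ℂ) * (conj (x i) * x j) / 2 := by
      intro i j
      rw [windowForm_hQ4_apply d hd, tQ4, Complex.star_def]
      by_cases hij : i = j
      · rw [if_pos hij, if_pos hij]; push_cast; ring
      · rw [if_neg hij, if_neg hij]; push_cast; ring
    have step1 : star x ⬝ᵥ (ffWindowForm 4 (frobRoots (hQ4 d)) (2 * d) *ᵥ x) =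
        ∑ i, ∑ j, star (x i) * (ffWindowForm 4 (frobRoots (hQ4 d)) (2 * d) i j * x j) := by
      simp only [dotProduct, Matrix.mulVec, Pi.star_apply]
      exact Finset.sum_congr rfl fun i _ => by rw [Finset.mul_sum]
    have hA : ∑ i : Fin (2 * d + 1), ∑ j, (2 * (d : ℂ) + 1) / 2 * (if i = j then conj (x i) * x j else 0) =
        (2 * d + 1) / 2 * ∑ i, conj (x i) * x i := by
      rw [Finset.mul_sum]
      refine Finset.sum_congr rfl fun i _ => ?_
      rw [← Finset.mul_sum, Finset.sum_ite_eq]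
      simp
    have hB : ∑ i : Fin (2 * d + 1), ∑ j, conj (x i) * x j / 2 = (∑ i, conj (x i)) * (∑ j, x j) / 2 := by
      rw [Finset.sum_mul_sum, Finset.sum_div]
      exact Finset.sum_congr rfl fun i _ => by rw [Finset.sum_div]
    have hC : ∑ i : Fin (2 * d + 1), ∑ j : Fin (2 * d + 1), (eDevQ4 d (Nat.dist i j) : ℂ) * (conj (x i) * x j) / 2 =
        (∑ i : Fin (2 * d + 1), ∑ j : Fin (2 * d + 1), (eDevQ4 d (Nat.dist i j) : ℂ) * (conj (x i) * x j)) / 2 := by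
      rw [Finset.sum_div]
      exact Finset.sum_congr rfl fun i _ => by rw [Finset.sum_div]
    rw [step1, Finset.sum_congr rfl fun i _ => Finset.sum_congr rfl fun j _ => hterm i j]
    simp only [Finset.sum_add_distrib]
    rw [hA, hB, hC]
  -- Step B: each piece is real.
  have hP1 : (∑ i, conj (x i) * x i) = ((∑ i, ‖x i‖ ^ 2 : ℝ) : ℂ) := by
    push_cast
    exact Finset.sum_congr rfl fun i _ => Complex.conj_mul' (x i)
  have hP2 : (∑ i, conj (x i)) * (∑ j, x j) = ((‖∑ i, x i‖ ^ 2 : ℝ) : ℂ) := by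
    rw [← map_sum, Complex.conj_mul']
    push_cast; rfl
  have hswap : (∑ i : Fin (2 * d + 1), ∑ j : Fin (2 * d + 1), (eDevQ4 d (Nat.dist i j) : ℂ) * (conj (x i) * x j)) =
      ∑ i : Fin (2 * d + 1), ∑ j : Fin (2 * d + 1), (eDevQ4 d (Nat.dist i j) : ℂ) * conj (conj (x i) * x j) := by
    rw [Finset.sum_comm]
    refine Finset.sum_congr rfl fun i _ => Finset.sum_congr rfl fun j _ => ?_
    rw [map_mul, Complex.conj_conj, he_symm i j, mul_comm (x i)]
  have hP3 : (∑ i : Fin (2 * d + 1), ∑ j : Fin (2 * d + 1), (eDevQ4 d (Nat.dist i j) : ℂ) * (conj (x i) * x j)) =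
      ((∑ i : Fin (2 * d + 1), ∑ j : Fin (2 * d + 1), eDevQ4 d (Nat.dist i j) * (conj (x i) * x j).re : ℝ) : ℂ) := by
    rw [show (∑ i : Fin (2 * d + 1), ∑ j : Fin (2 * d + 1), (eDevQ4 d (Nat.dist i j) : ℂ) * (conj (x i) * x j)) =
        ((∑ i : Fin (2 * d + 1), ∑ j : Fin (2 * d + 1), (eDevQ4 d (Nat.dist i j) : ℂ) * (conj (x i) * x j)) + ∑ i : Fin (2 * d + 1), ∑ j : Fin (2 * d + 1), (eDevQ4 d (Nat.dist i j) : ℂ) * conj (conj (x i) * x j)) / 2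
        from by rw [← hswap]; ring]
    rw [← Finset.sum_add_distrib]
    push_cast
    rw [Finset.sum_div]
    refine Finset.sum_congr rfl fun i _ => ?_
    rw [← Finset.sum_add_distrib, Finset.sum_div]
    refine Finset.sum_congr rfl fun j _ => ?_
    rw [← mul_add, Complex.add_conj]
    push_cast
    ring
  -- Step C: the real lower bound, by `|Re(x̄_i x_j)| ≤ (|x_i|² + |x_j|²)/2` and the Gershgorin row bound.
  have hre : ∀ i j, -(‖x i‖ * ‖x j‖) ≤ (conj (x i) * x j).re := by
    intro i j
    have h := (abs_le.1 (Complex.abs_re_le_norm (conj (x i) * x j))).1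
    rwa [norm_mul, Complex.norm_conj] at h
  have hterm : ∀ i j : Fin (2 * d + 1), -(eDevQ4 d (Nat.dist i j) / 2 * (‖x i‖ ^ 2 + ‖x j‖ ^ 2)) ≤
      eDevQ4 d (Nat.dist i j) * (conj (x i) * x j).re := by
    intro i j
    have h1 := hre i j
    have h2 := he0 i j
    have h3 : ‖x i‖ * ‖x j‖ ≤ (‖x i‖ ^ 2 + ‖x j‖ ^ 2) / 2 := by nlinarith [sq_nonneg (‖x i‖ - ‖x j‖)]
    nlinarith
  have hsym : ∑ i : Fin (2 * d + 1), ∑ j : Fin (2 * d + 1), eDevQ4 d (Nat.dist i j) / 2 * (‖x i‖ ^ 2 + ‖x j‖ ^ 2) =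
      ∑ i : Fin (2 * d + 1), (∑ j : Fin (2 * d + 1), eDevQ4 d (Nat.dist i j)) * ‖x i‖ ^ 2 := by
    have h1 : ∑ i : Fin (2 * d + 1), ∑ j : Fin (2 * d + 1), eDevQ4 d (Nat.dist i j) / 2 * ‖x j‖ ^ 2 =
        ∑ i : Fin (2 * d + 1), ∑ j : Fin (2 * d + 1), eDevQ4 d (Nat.dist i j) / 2 * ‖x i‖ ^ 2 := by
      rw [Finset.sum_comm]
      exact Finset.sum_congr rfl fun a _ => Finset.sum_congr rfl fun b _ => by rw [he_symm a b]
    simp only [mul_add, Finset.sum_add_distrib]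
    rw [h1, ← Finset.sum_add_distrib]
    refine Finset.sum_congr rfl fun i _ => ?_
    rw [← Finset.sum_add_distrib, Finset.sum_mul]
    exact Finset.sum_congr rfl fun j _ => by ring
  have hP3le : -((2 * d + 1) * ∑ i, ‖x i‖ ^ 2) ≤
      ∑ i : Fin (2 * d + 1), ∑ j : Fin (2 * d + 1), eDevQ4 d (Nat.dist i j) * (conj (x i) * x j).re := by
    have hrow := fun i => rowsum_eDevQ4_le d hd i
    calc -((2 * d + 1) * ∑ i, ‖x i‖ ^ 2) = -(∑ i : Fin (2 * d + 1), (2 * d + 1) * ‖x i‖ ^ 2) := by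
          rw [Finset.mul_sum]
      _ ≤ -(∑ i : Fin (2 * d + 1), (∑ j : Fin (2 * d + 1), eDevQ4 d (Nat.dist i j)) * ‖x i‖ ^ 2) := by
          apply neg_le_neg
          exact Finset.sum_le_sum fun i _ => mul_le_mul_of_nonneg_right (hrow i) (by positivity)
      _ = ∑ i : Fin (2 * d + 1), ∑ j : Fin (2 * d + 1), -(eDevQ4 d (Nat.dist i j) / 2 * (‖x i‖ ^ 2 + ‖x j‖ ^ 2)) := by
          rw [← hsym]; simp only [Finset.sum_neg_distrib]
      _ ≤ _ := Finset.sum_le_sum fun i _ => Finset.sum_le_sum fun j _ => hterm i j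
  have hsq : 0 ≤ ‖∑ i, x i‖ ^ 2 := by positivity
  have hA : 0 ≤ ∑ i : Fin (2 * d + 1), ‖x i‖ ^ 2 := Finset.sum_nonneg fun i _ => by positivity
  rw [hQ, hP1, hP2, hP3]
  have hreal : ((2 * d + 1) / 2 * (((∑ i, ‖x i‖ ^ 2 : ℝ)) : ℂ) + ((‖∑ i, x i‖ ^ 2 : ℝ) : ℂ) / 2 +
      ((∑ i : Fin (2 * d + 1), ∑ j : Fin (2 * d + 1), eDevQ4 d (Nat.dist i j) * (conj (x i) * x j).re : ℝ) : ℂ) / 2 : ℂ) =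
      (((2 * d + 1) / 2 * (∑ i, ‖x i‖ ^ 2) + ‖∑ i, x i‖ ^ 2 / 2 +
        (∑ i : Fin (2 * d + 1), ∑ j : Fin (2 * d + 1), eDevQ4 d (Nat.dist i j) * (conj (x i) * x j).re) / 2 : ℝ) : ℂ) := by
    push_cast; ring
  rw [hreal]
  exact Complex.zero_le_real.2 (by nlinarith)

/-! ## `H_d` violates the function-field RH: a real root in `(2, 4]` -/

/-- `H_d(2) = -2^{d+3} < 0 < H_d(4)`, so `H_d` has a real root `x₀ > 2 = √q`. [folklore] -/
theorem exists_real_root_hQ4 (d : ℕ) (hd : 2 ≤ d) :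
    ∃ x : ℝ, 2 < x ∧ ((hQ4 d).map (Int.castRingHom ℝ)).IsRoot x := by
  set f : ℝ → ℝ := fun x => ((hQ4 d).map (Int.castRingHom ℝ)).eval x with hf
  have hfe : ∀ x, f x = x ^ (2 * d + 2) - 2 * x ^ (2 * d + 1) - x ^ (d + 2) - 4 * x ^ d
      - 2 ^ (2 * d + 1) * x + 2 ^ (2 * d + 2) := by
    intro x
    simp only [hf, hQ4, eval_map, eval₂_add, eval₂_sub, eval₂_mul, eval₂_X_pow, eval₂_C, eval₂_X]
    simp only [eq_intCast, Int.cast_pow, Int.cast_ofNat]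
  have h2 : f 2 = -2 ^ (d + 3) := by rw [hfe]; ring
  have h4 : f (2 ^ 2) = 2 ^ (2 * d + 3) * (2 ^ (2 * d) - 3) := by
    rw [hfe, ← pow_mul, ← pow_mul, ← pow_mul, ← pow_mul]; ring
  have hpos : 0 < f (2 ^ 2) := by
    rw [h4]
    have : (4:ℝ) ≤ 2 ^ (2 * d) := by
      calc (4:ℝ) = 2 ^ 2 := by norm_num
        _ ≤ 2 ^ (2 * d) := pow_le_pow_right₀ (by norm_num) (by omega)
    have h8 : (0:ℝ) < 2 ^ (2 * d + 3) := by positivity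
    nlinarith
  have hneg : f 2 < 0 := by rw [h2]; exact neg_lt_zero.2 (by positivity)
  have hcont : ContinuousOn f (Set.Icc 2 (2 ^ 2)) := (Polynomial.continuous _).continuousOn
  obtain ⟨x, hx, hfx⟩ := intermediate_value_Icc (show (2:ℝ) ≤ 2 ^ 2 by norm_num) hcont
    ⟨hneg.le, hpos.le⟩
  refine ⟨x, ?_, hfx⟩
  rcases eq_or_lt_of_le hx.1 with h | h
  · subst h; rw [hfx] at hneg; exact absurd hneg (lt_irrefl 0)
  · exact h

/-- Hence an off-circle root: `H_d` is NOT a `4`-Weil polynomial (function-field RH fails). [folklore] -/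
theorem exists_offCircle_hQ4 (d : ℕ) (hd : 2 ≤ d) :
    ∃ α ∈ frobRoots (hQ4 d), ‖α‖ ≠ Real.sqrt 4 := by
  obtain ⟨x, hx2, hroot⟩ := exists_real_root_hQ4 d hd
  refine ⟨(x : ℂ), ?_, ?_⟩
  · have hne : (hQ4 d).map (Int.castRingHom ℂ) ≠ 0 := ((hQ4_monic d hd).map _).ne_zero
    rw [frobRoots, mem_roots hne]
    have hmap : (hQ4 d).map (Int.castRingHom ℂ) = ((hQ4 d).map (Int.castRingHom ℝ)).map (algebraMap ℝ ℂ) := by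
      rw [Polynomial.map_map]; congr 1
    rw [hmap]
    simpa using hroot.map (f := algebraMap ℝ ℂ)
  · rw [Literature.NumberTheory.EllipticCurves.sqrt_four, Complex.norm_real, Real.norm_eq_abs,
      abs_of_pos (by linarith)]
    exact ne_of_gt hx2

/-! ## The sharpness theorem at `q = 4`, `g = d + 1 ≥ 6` -/

/-- SHARPNESS OF THE POSITIVITY DEPTH AT THE FIXED PRIME POWER `q = 4` (door D-D rider R2 = ADJ-LOG A290 (A3),
and rider R1 at `q = 2²`): for every `d ≥ 3` (`g = d + 1 ≥ 4`) the MONIC, FE-honest integer polynomial `H_d` of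
degree `2g` violates the function-field RH at `q = 4`, yet its window form of depth `2g - 2 = 2d` is positive
semidefinite — while depth `2g - 1` fails, as it must by the finite Weil criterion. [folklore] -/
theorem sharp_witness_q4 (d : ℕ) (hd : 3 ≤ d) :
    (hQ4 d).Monic ∧
    (frobRoots (hQ4 d)).map (fun α => ((4 : ℝ) : ℂ) / α) = frobRoots (hQ4 d) ∧
    (0 : ℂ) ∉ frobRoots (hQ4 d) ∧ (hQ4 d).natDegree = 2 * (d + 1) ∧
    ¬ (∀ α ∈ frobRoots (hQ4 d), ‖α‖ = Real.sqrt 4) ∧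
    (weilWindowForm 4 (hQ4 d) (2 * d)).PosSemidef ∧
    ¬ (weilWindowForm 4 (hQ4 d) (2 * d + 1)).PosSemidef := by
  have hd2 : 2 ≤ d := by omega
  have hrec := frobRoots_hQ4_reciprocal d hd2
  have h0 := zero_not_mem_frobRoots_hQ4 d hd2
  have hoff := exists_offCircle_hQ4 d hd2
  refine ⟨hQ4_monic d hd2, hrec, h0, by rw [natDegree_hQ4 d hd2]; ring, ?_, ?_, ?_⟩
  · intro hall; obtain ⟨α, hα, hne⟩ := hoff; exact hne (hall α hα)
  · exact windowForm_hQ4_posSemidef d hd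
  · exact weilWindowForm_not_posSemidef_of_offCircle (by norm_num) hrec h0 hoff
      (by rw [natDegree_hQ4 d hd2])

end Summit.RiemannHypothesis.RiemannHypothesis.Theorems.PfPersistence.FfAngleTwin

end
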